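import Summits.Ventures.CertifiedManyBodySolver.Rows.SourcedTorusRowsOnePointKKT
import Literature.MathematicalPhysics.QuantumLattice.DWaveSourceNNNHoppingWindowCertificateKKTEnergyWindow
import HarnessLib

/-!
# PINNING-FIELD rows: KKT window certificates inside a TWO-SIDED energy window (q-slotted ceiling row AND
# an imported energy floor row) ⇒ ground-state cells and response leaves

HONEST FRAMING: first certified bounds on pairing observables; not a superconductivity verdict; every
number certified (two lineages + referee) or labelled float. A response AT FIXED `h > 0` is
symmetry-allowed and says nothing about spontaneous order.

WHAT THIS FILE IS (cell hubbard-cq, D-0082 (c) / LADDER row PC-a, seat hubbard-cq-obsth-1 "pinning-field K5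
menu nodes"; sequel of `Rows/SourcedTorusRowsOnePointKKTEnergy.lean`). The tree theorem
`re_orbitState_ge_of_sourced_window_certificate_d4_TT'_kkt_of_energy_window`
(`Literature/…/DWaveSourceNNNHoppingWindowCertificateKKTEnergyWindow.lean`) reads ONE window identity

  `X − c·1 − κ⁺ (u·1 − E^{src,tt'}) − κ⁻ (E^{src,tt'} − ℓ·1) = SOS + Σ[H^{src,tt'}_{Λ'}, Γ(incl)Bₖ] + Σ(affine-D₄ defects)
   + Σ bⱼ wⱼ + Σ dₘ(Vₘᴴ − Vₘ) + Σ aₖ vₖ + kktForm H^{src,tt'}_{Λ'} G (Γ(incl) ∘ B)`      (`κ⁺, κ⁻ ≥ 0`, `G ⪰ 0`)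

in the orbit state of every `S^z`-eigenvector GROUND vector of the pair-sourced `t–t'` torus, given a certified energy
CEILING `E₀(A_L) ≤ u·L²` (a trial-state row) AND a certified energy FLOOR `ℓ·L² ≤ E₀(A_L)` (the energy certificate
of a larger relaxation imported as a ROW into the one-point program — the sourced `e_lo(h)` cell of the menus;
Wang et al. 2024 §III). This file turns it into cells and leaves:

* §1 one torus: `SourcedTorusCorrLowerRowGS.of_window_certificate_kkt_of_energyRows` (identity + the two energy
  cells `SourcedTorusEnergyUpperRow L … u`, `SourcedTorusEnergyLowerRow L … ℓ` ⇒ ground-state LOWER cell at every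
  `r ≤ c − Σₖ ‖aₖ‖`);
* §2 uniform: `SourcedCorrLowerRowGS.of_window_certificate_kkt_of_energyRows` (ceiling row along `q ∣ L`, floor row
  along `q' ∣ L` with `q' ∣ q` — `q' = 1` for a translation-invariant floor certificate — ⇒ `∃ L₁`, uniform cell
  along `q`);
* §3 the ONE-POINT objective `Γ(incl)(Φ₀ + Φ₀ᴴ)`: `pinFieldResponseFloorAt_of_onePoint_window_certificate_kkt_of_energyRows`
  (`∃ L₁, PinFieldResponseFloorAt tp U μ h q L₁ (r/2)`) and the MAX program's
  `pinFieldResponseCeilingAt_of_onePoint_window_certificate_kkt_of_energyRows`.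

NOTHING IS ASSERTED: identities and rows in, cells / leaves out; no certificate, no number, no `sorry`, no named
fact. No definition. Elaborated under the torus files' local `DecidableEq (FermionTorus 2 L)` instance (cells met
literally).

References: T. Koma, H. Tasaki, J. Stat. Phys. 76 (1994) 745, §1; J. Wang et al., PRX 14 (2024) 031006, §III;
M. Araújo et al., arXiv:2311.18707 §3.2 Prop. 11; O. Bratteli, D. W. Robinson II Prop. 5.3.19, §6.2.4.
-/

noncomputable section

namespace Summit.Ventures.CertifiedManyBodySolver

open Literature.MathematicalPhysics.QuantumLattice
open Matrix HubbardWave0 Literature.Probability.LatticeModels Finset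
open Literature.MathematicalPhysics.QuantumManyBody.StateRelaxation
open Summit.Ventures.CertifiedManyBodySolver.Observables
open scoped BigOperators ComplexOrder

/-- (Local to this file, as in `Rows/SourcedTorusRows[KKTHook]`.) -/
local instance (priority := high) instDecidableEqFermionTorusSourcedKKTEWHook {L : ℕ} :
    DecidableEq (FermionTorus 2 L) :=
  LinearOrder.toDecidableEq

/-! ## §1  One torus: KKT window identity inside a two-sided energy window ⇒ the ground-state LOWER cell -/

section OneTorus

variable {L : ℕ} [NeZero L]

/-- **KKT window identity with a TWO-SIDED energy window + the two energy cells ⇒ the ground-state LOWER cell.**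
The identity of `re_orbitState_ge_of_sourced_window_certificate_d4_TT'_kkt_of_energy_window` (energy terms
`κ⁺ (u·1 − E^{src,tt'}) + κ⁻ (E^{src,tt'} − ℓ·1)`, `κ⁺, κ⁻ ≥ 0`, rational `u, ℓ`) together with
`SourcedTorusEnergyUpperRow L tp U μ h u` (`E₀(A_L) ≤ u·L²`) and `SourcedTorusEnergyLowerRow L tp U μ h ℓ`
(`ℓ·L² ≤ E₀(A_L)`) gives `SourcedTorusCorrLowerRowGS L tp U μ h r Λ' hInj' S Xw` at every `r ≤ c − Σₖ ‖aₖ‖`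
(`L ≥ 3`, `x ↦ x mod L` injective on `thicken Λ' 1`). [cite: WangEtAl2024, §III] -/
theorem SourcedTorusCorrLowerRowGS.of_window_certificate_kkt_of_energyRows (tp U μ h : ℝ) (hL : 3 ≤ L)
    {u ℓ r : ℚ} (hE : SourcedTorusEnergyUpperRow L tp U μ h u) (hF : SourcedTorusEnergyLowerRow L tp U μ h ℓ)
    {Λ Λ' : Finset (Site 2)} (hΛ : Λ ⊆ Λ') (h8 : thicken Λ 1 ⊆ Λ')
    (h0 : thicken ({0} : Finset (Site 2)) 1 ⊆ Λ') (hz : (0 : Site 2) ∈ Λ')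
    (hP : pairRegion (insert (0 : Site 2) unitSteps) 0 ⊆ Λ')
    (hInj : Set.InjOn (Torus.proj (d := 2) L) ↑(thicken Λ' 1))
    (hInj' : Set.InjOn (Torus.proj (d := 2) L) ↑Λ')
    {S : Finset (DihedralGroup 4)} (h1 : (1 : DihedralGroup 4) ∈ S) (hmul : ∀ a ∈ S, ∀ b ∈ S, a * b ∈ S)
    (hS : ∀ γ ∈ S, b1gChar γ = 1) (Xw : FermionOp Λ') {κp κm : ℝ} (hκp : 0 ≤ κp) (hκm : 0 ≤ κm)
    {m : Type*} [Fintype m] [DecidableEq m] {Λm : Matrix m m ℂ} (hΛm : Λm.PosSemidef)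
    (O : m → FermionOp Λ')
    {κ' : Type*} (s : Finset κ') (B : κ' → FermionOp Λ)
    {ι : Type*} (tt : Finset ι) (γ : ι → DihedralGroup 4) (hγS : ∀ l ∈ tt, γ l ∈ S) (wv : ι → Site 2)
    (hsh : ∀ l, d4ShiftSet (γ l) (wv l) Λ ⊆ Λ') (Y : ι → FermionOp Λ)
    {ρ : Type*} (uu : Finset ρ) (b : ρ → ℂ) (cw : ρ → List (Orb (PolySite Λ') × Bool))
    (hcw : ∀ j ∈ uu, ladderSpinCharge (cw j) ≠ 0)
    {δ : Type*} (ah : Finset δ) (dc : δ → ℝ) (V : δ → FermionOp Λ')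
    {κ'' : Type*} (w : Finset κ'') (a : κ'' → ℂ) (word : κ'' → List (Orb (PolySite Λ') × Bool))
    {β : Type*} [Fintype β] [DecidableEq β] {G : Matrix β β ℂ} (hG : G.PosSemidef)
    (Bk : β → FermionOp Λ) {c : ℝ}
    (hcert : Xw - (c : ℂ) • (1 : FermionOp Λ') -
        ((κp : ℝ) : ℂ) • ((((u : ℚ) : ℝ) : ℂ) • (1 : FermionOp Λ') -
          (fermionEmbed (PolySite.incl h0) ((hubbardTTPrimeFermionInteraction 1 tp U).meanEnergyObs 1) -
            (μ : ℂ) • ∑ σ : Fin 2, nAt 0 hz σ -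
            (h : ℂ) • (fermionEmbed (PolySite.incl hP) (localPairAt (insert (0 : Site 2) unitSteps) dWaveFormFactor 0) +
              (fermionEmbed (PolySite.incl hP) (localPairAt (insert (0 : Site 2) unitSteps) dWaveFormFactor 0))ᴴ))) -
        ((κm : ℝ) : ℂ) • ((fermionEmbed (PolySite.incl h0) ((hubbardTTPrimeFermionInteraction 1 tp U).meanEnergyObs 1) -
            (μ : ℂ) • ∑ σ : Fin 2, nAt 0 hz σ -
            (h : ℂ) • (fermionEmbed (PolySite.incl hP) (localPairAt (insert (0 : Site 2) unitSteps) dWaveFormFactor 0) +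
              (fermionEmbed (PolySite.incl hP) (localPairAt (insert (0 : Site 2) unitSteps) dWaveFormFactor 0))ᴴ)) -
          (((ℓ : ℚ) : ℝ) : ℂ) • (1 : FermionOp Λ')) =
      gramForm Λm O +
        (∑ k ∈ s, (pairSourceWindowHamiltonianTT' dWaveFormFactor Λ' tp U μ h * fermionEmbed (PolySite.incl hΛ) (B k) -
            fermionEmbed (PolySite.incl hΛ) (B k) * pairSourceWindowHamiltonianTT' dWaveFormFactor Λ' tp U μ h) +
          ∑ l ∈ tt, (fermionEmbed (PolySite.incl (hsh l)) (fermionEmbed (PolySite.d4Emb (γ l) (wv l) Λ) (Y l)) -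
            fermionEmbed (PolySite.incl hΛ) (Y l)) +
          ∑ j ∈ uu, b j • ladderWord (cw j)) +
        (∑ m' ∈ ah, ((dc m' : ℝ) : ℂ) • ((V m')ᴴ - V m') + ∑ k ∈ w, a k • ladderWord (word k)) +
        kktForm (pairSourceWindowHamiltonianTT' dWaveFormFactor Λ' tp U μ h) G
          (fun b' => fermionEmbed (PolySite.incl hΛ) (Bk b')))
    (hr : ((r : ℚ) : ℝ) ≤ c - ∑ k ∈ w, ‖a k‖) :
    SourcedTorusCorrLowerRowGS L tp U μ h r Λ' hInj' S Xw := by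
  intro M ψ hψK hψ1 hgs
  have hLsq : (0 : ℝ) < (L : ℝ) ^ 2 := by
    have : (0 : ℝ) < (L : ℝ) := by exact_mod_cast Nat.pos_of_ne_zero (NeZero.ne L)
    positivity
  have hu : (dWaveSourceTorusTT' L tp U μ h).groundEnergy / (L : ℝ) ^ 2 ≤ ((u : ℚ) : ℝ) := by
    rw [div_le_iff₀ hLsq]
    exact hE
  have hℓ : ((ℓ : ℚ) : ℝ) ≤ (dWaveSourceTorusTT' L tp U μ h).groundEnergy / (L : ℝ) ^ 2 := by
    rw [le_div_iff₀ hLsq]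
    exact hF
  exact hr.trans (re_orbitState_ge_of_sourced_window_certificate_d4_TT'_kkt_of_energy_window tp U μ h hL hΛ h8 h0 hz
    hP hInj hInj' h1 hmul hS hψK hψ1 hgs.2 Xw hκp hκm hu hℓ hΛm O s B tt γ hγS wv hsh Y uu b cw hcw ah dc V w a word
    hG Bk hcert)

end OneTorus

/-! ## §2  Uniform in `L`: the two-sided window from ONE identity and two uniform energy rows -/

section Uniform

/-- **KKT window identity inside a two-sided energy window + the uniform energy CEILING row along `q ∣ L` and the
uniform energy FLOOR row along `q' ∣ L` with `q' ∣ q` (e.g. `q' = 1`: a translation-invariant floor certificate)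
⇒ the uniform ground-state LOWER cell along `q`.** [cite: WangEtAl2024, §III] -/
theorem SourcedCorrLowerRowGS.of_window_certificate_kkt_of_energyRows (tp U μ h : ℝ) {u ℓ r : ℚ}
    {q L₀ q' L₀' : ℕ} (hE : SourcedEnergyUpperRow tp U μ h q L₀ u) (hF : SourcedEnergyLowerRow tp U μ h q' L₀' ℓ)
    (hq : q' ∣ q)
    {Λ Λ' : Finset (Site 2)} (hΛ : Λ ⊆ Λ') (h8 : thicken Λ 1 ⊆ Λ')
    (h0 : thicken ({0} : Finset (Site 2)) 1 ⊆ Λ') (hz : (0 : Site 2) ∈ Λ')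
    (hP : pairRegion (insert (0 : Site 2) unitSteps) 0 ⊆ Λ')
    {S : Finset (DihedralGroup 4)} (h1 : (1 : DihedralGroup 4) ∈ S) (hmul : ∀ a ∈ S, ∀ b ∈ S, a * b ∈ S)
    (hS : ∀ γ ∈ S, b1gChar γ = 1) (Xw : FermionOp Λ') {κp κm : ℝ} (hκp : 0 ≤ κp) (hκm : 0 ≤ κm)
    {m : Type*} [Fintype m] [DecidableEq m] {Λm : Matrix m m ℂ} (hΛm : Λm.PosSemidef)
    (O : m → FermionOp Λ')
    {κ' : Type*} (s : Finset κ') (B : κ' → FermionOp Λ)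
    {ι : Type*} (tt : Finset ι) (γ : ι → DihedralGroup 4) (hγS : ∀ l ∈ tt, γ l ∈ S) (wv : ι → Site 2)
    (hsh : ∀ l, d4ShiftSet (γ l) (wv l) Λ ⊆ Λ') (Y : ι → FermionOp Λ)
    {ρ : Type*} (uu : Finset ρ) (b : ρ → ℂ) (cw : ρ → List (Orb (PolySite Λ') × Bool))
    (hcw : ∀ j ∈ uu, ladderSpinCharge (cw j) ≠ 0)
    {δ : Type*} (ah : Finset δ) (dc : δ → ℝ) (V : δ → FermionOp Λ')
    {κ'' : Type*} (w : Finset κ'') (a : κ'' → ℂ) (word : κ'' → List (Orb (PolySite Λ') × Bool))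
    {β : Type*} [Fintype β] [DecidableEq β] {G : Matrix β β ℂ} (hG : G.PosSemidef)
    (Bk : β → FermionOp Λ) {c : ℝ}
    (hcert : Xw - (c : ℂ) • (1 : FermionOp Λ') -
        ((κp : ℝ) : ℂ) • ((((u : ℚ) : ℝ) : ℂ) • (1 : FermionOp Λ') -
          (fermionEmbed (PolySite.incl h0) ((hubbardTTPrimeFermionInteraction 1 tp U).meanEnergyObs 1) -
            (μ : ℂ) • ∑ σ : Fin 2, nAt 0 hz σ -
            (h : ℂ) • (fermionEmbed (PolySite.incl hP) (localPairAt (insert (0 : Site 2) unitSteps) dWaveFormFactor 0) +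
              (fermionEmbed (PolySite.incl hP) (localPairAt (insert (0 : Site 2) unitSteps) dWaveFormFactor 0))ᴴ))) -
        ((κm : ℝ) : ℂ) • ((fermionEmbed (PolySite.incl h0) ((hubbardTTPrimeFermionInteraction 1 tp U).meanEnergyObs 1) -
            (μ : ℂ) • ∑ σ : Fin 2, nAt 0 hz σ -
            (h : ℂ) • (fermionEmbed (PolySite.incl hP) (localPairAt (insert (0 : Site 2) unitSteps) dWaveFormFactor 0) +
              (fermionEmbed (PolySite.incl hP) (localPairAt (insert (0 : Site 2) unitSteps) dWaveFormFactor 0))ᴴ)) -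
          (((ℓ : ℚ) : ℝ) : ℂ) • (1 : FermionOp Λ')) =
      gramForm Λm O +
        (∑ k ∈ s, (pairSourceWindowHamiltonianTT' dWaveFormFactor Λ' tp U μ h * fermionEmbed (PolySite.incl hΛ) (B k) -
            fermionEmbed (PolySite.incl hΛ) (B k) * pairSourceWindowHamiltonianTT' dWaveFormFactor Λ' tp U μ h) +
          ∑ l ∈ tt, (fermionEmbed (PolySite.incl (hsh l)) (fermionEmbed (PolySite.d4Emb (γ l) (wv l) Λ) (Y l)) -
            fermionEmbed (PolySite.incl hΛ) (Y l)) +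
          ∑ j ∈ uu, b j • ladderWord (cw j)) +
        (∑ m' ∈ ah, ((dc m' : ℝ) : ℂ) • ((V m')ᴴ - V m') + ∑ k ∈ w, a k • ladderWord (word k)) +
        kktForm (pairSourceWindowHamiltonianTT' dWaveFormFactor Λ' tp U μ h) G
          (fun b' => fermionEmbed (PolySite.incl hΛ) (Bk b')))
    (hr : ((r : ℚ) : ℝ) ≤ c - ∑ k ∈ w, ‖a k‖) :
    ∃ L₁ : ℕ, SourcedCorrLowerRowGS tp U μ h q L₁ r Λ' S Xw := by
  obtain ⟨L₂, hL₂⟩ := exists_forall_le_injOn_proj (thicken Λ' 1)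
  refine ⟨max (max 3 L₂) (max L₀ L₀'), fun L _ hInj' hL hqL => ?_⟩
  have h3 : 3 ≤ L := le_trans (le_max_left _ _) (le_trans (le_max_left _ _) hL)
  have hL2 : L₂ ≤ L := le_trans (le_max_right _ _) (le_trans (le_max_left _ _) hL)
  have hL0 : L₀ ≤ L := le_trans (le_max_left _ _) (le_trans (le_max_right _ _) hL)
  have hL0' : L₀' ≤ L := le_trans (le_max_right _ _) (le_trans (le_max_right _ _) hL)
  exact SourcedTorusCorrLowerRowGS.of_window_certificate_kkt_of_energyRows tp U μ h h3 (hE L hL0 hqL)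
    (hF L hL0' (dvd_trans hq hqL)) hΛ h8 h0 hz hP (hL₂ L hL2) hInj' h1 hmul hS Xw hκp hκm hΛm O s B tt γ hγS wv hsh Y
    uu b cw hcw ah dc V w a word hG Bk hcert hr

end Uniform

/-! ## §3  End to end: the ONE-POINT objective inside a two-sided energy window ⇒ response FLOOR / CEILING leaf -/

section OnePoint

/-- **A KKT one-point window certificate inside a TWO-SIDED energy window is, end to end, a response FLOOR
leaf.** The identity of `re_orbitState_ge_of_sourced_window_certificate_d4_TT'_kkt_of_energy_window` for the
objective `Γ(incl)(Φ₀ + Φ₀ᴴ)` (energy terms `κ⁺ (u·1 − E^{src,tt'}) + κ⁻ (E^{src,tt'} − ℓ·1)`, `κ⁺, κ⁻ ≥ 0`),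
the energy ceiling row along `q ∣ L`, the energy floor row along `q' ∣ L` (`q' ∣ q`) and a slot
`r ≤ c − Σₖ ‖aₖ‖` give `∃ L₁, PinFieldResponseFloorAt tp U μ h q L₁ (r/2)` — `r/2 ≤ m_L(h)` on every side
`L ≥ L₁` with `q ∣ L`. [cite: KomaTasaki1994, §1] [cite: WangEtAl2024, §III] -/
theorem pinFieldResponseFloorAt_of_onePoint_window_certificate_kkt_of_energyRows (tp U μ h : ℝ) {u ℓ r : ℚ}
    {q L₀ q' L₀' : ℕ} (hE : SourcedEnergyUpperRow tp U μ h q L₀ u) (hF : SourcedEnergyLowerRow tp U μ h q' L₀' ℓ)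
    (hq : q' ∣ q)
    {Λ Λ' : Finset (Site 2)} (hΛ : Λ ⊆ Λ') (h8 : thicken Λ 1 ⊆ Λ')
    (h0 : thicken ({0} : Finset (Site 2)) 1 ⊆ Λ') (hz : (0 : Site 2) ∈ Λ')
    (hP : pairRegion (insert (0 : Site 2) unitSteps) 0 ⊆ Λ')
    {S : Finset (DihedralGroup 4)} (h1 : (1 : DihedralGroup 4) ∈ S) (hmul : ∀ a ∈ S, ∀ b ∈ S, a * b ∈ S)
    (hS : ∀ γ ∈ S, b1gChar γ = 1) {κp κm : ℝ} (hκp : 0 ≤ κp) (hκm : 0 ≤ κm)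
    {m : Type*} [Fintype m] [DecidableEq m] {Λm : Matrix m m ℂ} (hΛm : Λm.PosSemidef)
    (O : m → FermionOp Λ')
    {κ' : Type*} (s : Finset κ') (B : κ' → FermionOp Λ)
    {ι : Type*} (tt : Finset ι) (γ : ι → DihedralGroup 4) (hγS : ∀ l ∈ tt, γ l ∈ S) (wv : ι → Site 2)
    (hsh : ∀ l, d4ShiftSet (γ l) (wv l) Λ ⊆ Λ') (Y : ι → FermionOp Λ)
    {ρ : Type*} (uu : Finset ρ) (b : ρ → ℂ) (cw : ρ → List (Orb (PolySite Λ') × Bool))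
    (hcw : ∀ j ∈ uu, ladderSpinCharge (cw j) ≠ 0)
    {δ : Type*} (ah : Finset δ) (dc : δ → ℝ) (V : δ → FermionOp Λ')
    {κ'' : Type*} (w : Finset κ'') (a : κ'' → ℂ) (word : κ'' → List (Orb (PolySite Λ') × Bool))
    {β : Type*} [Fintype β] [DecidableEq β] {G : Matrix β β ℂ} (hG : G.PosSemidef)
    (Bk : β → FermionOp Λ) {c : ℝ}
    (hcert : fermionEmbed (PolySite.incl hP) onePointPairWord - (c : ℂ) • (1 : FermionOp Λ') -
        ((κp : ℝ) : ℂ) • ((((u : ℚ) : ℝ) : ℂ) • (1 : FermionOp Λ') -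
          (fermionEmbed (PolySite.incl h0) ((hubbardTTPrimeFermionInteraction 1 tp U).meanEnergyObs 1) -
            (μ : ℂ) • ∑ σ : Fin 2, nAt 0 hz σ -
            (h : ℂ) • (fermionEmbed (PolySite.incl hP) (localPairAt (insert (0 : Site 2) unitSteps) dWaveFormFactor 0) +
              (fermionEmbed (PolySite.incl hP) (localPairAt (insert (0 : Site 2) unitSteps) dWaveFormFactor 0))ᴴ))) -
        ((κm : ℝ) : ℂ) • ((fermionEmbed (PolySite.incl h0) ((hubbardTTPrimeFermionInteraction 1 tp U).meanEnergyObs 1) -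
            (μ : ℂ) • ∑ σ : Fin 2, nAt 0 hz σ -
            (h : ℂ) • (fermionEmbed (PolySite.incl hP) (localPairAt (insert (0 : Site 2) unitSteps) dWaveFormFactor 0) +
              (fermionEmbed (PolySite.incl hP) (localPairAt (insert (0 : Site 2) unitSteps) dWaveFormFactor 0))ᴴ)) -
          (((ℓ : ℚ) : ℝ) : ℂ) • (1 : FermionOp Λ')) =
      gramForm Λm O +
        (∑ k ∈ s, (pairSourceWindowHamiltonianTT' dWaveFormFactor Λ' tp U μ h * fermionEmbed (PolySite.incl hΛ) (B k) -
            fermionEmbed (PolySite.incl hΛ) (B k) * pairSourceWindowHamiltonianTT' dWaveFormFactor Λ' tp U μ h) +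
          ∑ l ∈ tt, (fermionEmbed (PolySite.incl (hsh l)) (fermionEmbed (PolySite.d4Emb (γ l) (wv l) Λ) (Y l)) -
            fermionEmbed (PolySite.incl hΛ) (Y l)) +
          ∑ j ∈ uu, b j • ladderWord (cw j)) +
        (∑ m' ∈ ah, ((dc m' : ℝ) : ℂ) • ((V m')ᴴ - V m') + ∑ k ∈ w, a k • ladderWord (word k)) +
        kktForm (pairSourceWindowHamiltonianTT' dWaveFormFactor Λ' tp U μ h) G
          (fun b' => fermionEmbed (PolySite.incl hΛ) (Bk b')))
    (hr : ((r : ℚ) : ℝ) ≤ c - ∑ k ∈ w, ‖a k‖) :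
    ∃ L₁ : ℕ, PinFieldResponseFloorAt tp U μ h q L₁ (r / 2) := by
  obtain ⟨L₁, hL₁⟩ := SourcedCorrLowerRowGS.of_window_certificate_kkt_of_energyRows tp U μ h hE hF hq hΛ h8 h0 hz hP
    h1 hmul hS (fermionEmbed (PolySite.incl hP) onePointPairWord) hκp hκm hΛm O s B tt γ hγS wv hsh Y uu b cw hcw ah
    dc V w a word hG Bk hcert hr
  obtain ⟨L₂, hL₂⟩ := hL₁.onePoint_canonical h1 hmul hS hP
  exact ⟨max L₂ 3, hL₂.pinFieldResponseFloorAt⟩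

/-- **MAX program inside a two-sided energy window: a KKT one-point certificate for `−Γ(incl)(Φ₀ + Φ₀ᴴ)` with the
energy terms `κ⁺ (u·1 − E^{src,tt'}) + κ⁻ (E^{src,tt'} − ℓ·1)` (`κ⁺, κ⁻ ≥ 0`), plus the two energy rows, is a response
CEILING leaf** `∃ L₁, PinFieldResponseCeilingAt tp U μ h q L₁ (−r/2)` (`m_L(h) ≤ −r/2`) for `r ≤ c − Σₖ ‖aₖ‖`.
[cite: KomaTasaki1994, §1] [cite: WangEtAl2024, §III] -/
theorem pinFieldResponseCeilingAt_of_onePoint_window_certificate_kkt_of_energyRows (tp U μ h : ℝ) {u ℓ r : ℚ}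
    {q L₀ q' L₀' : ℕ} (hE : SourcedEnergyUpperRow tp U μ h q L₀ u) (hF : SourcedEnergyLowerRow tp U μ h q' L₀' ℓ)
    (hq : q' ∣ q)
    {Λ Λ' : Finset (Site 2)} (hΛ : Λ ⊆ Λ') (h8 : thicken Λ 1 ⊆ Λ')
    (h0 : thicken ({0} : Finset (Site 2)) 1 ⊆ Λ') (hz : (0 : Site 2) ∈ Λ')
    (hP : pairRegion (insert (0 : Site 2) unitSteps) 0 ⊆ Λ')
    {S : Finset (DihedralGroup 4)} (h1 : (1 : DihedralGroup 4) ∈ S) (hmul : ∀ a ∈ S, ∀ b ∈ S, a * b ∈ S)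
    (hS : ∀ γ ∈ S, b1gChar γ = 1) {κp κm : ℝ} (hκp : 0 ≤ κp) (hκm : 0 ≤ κm)
    {m : Type*} [Fintype m] [DecidableEq m] {Λm : Matrix m m ℂ} (hΛm : Λm.PosSemidef)
    (O : m → FermionOp Λ')
    {κ' : Type*} (s : Finset κ') (B : κ' → FermionOp Λ)
    {ι : Type*} (tt : Finset ι) (γ : ι → DihedralGroup 4) (hγS : ∀ l ∈ tt, γ l ∈ S) (wv : ι → Site 2)
    (hsh : ∀ l, d4ShiftSet (γ l) (wv l) Λ ⊆ Λ') (Y : ι → FermionOp Λ)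
    {ρ : Type*} (uu : Finset ρ) (b : ρ → ℂ) (cw : ρ → List (Orb (PolySite Λ') × Bool))
    (hcw : ∀ j ∈ uu, ladderSpinCharge (cw j) ≠ 0)
    {δ : Type*} (ah : Finset δ) (dc : δ → ℝ) (V : δ → FermionOp Λ')
    {κ'' : Type*} (w : Finset κ'') (a : κ'' → ℂ) (word : κ'' → List (Orb (PolySite Λ') × Bool))
    {β : Type*} [Fintype β] [DecidableEq β] {G : Matrix β β ℂ} (hG : G.PosSemidef)
    (Bk : β → FermionOp Λ) {c : ℝ}
    (hcert : -fermionEmbed (PolySite.incl hP) onePointPairWord - (c : ℂ) • (1 : FermionOp Λ') -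
        ((κp : ℝ) : ℂ) • ((((u : ℚ) : ℝ) : ℂ) • (1 : FermionOp Λ') -
          (fermionEmbed (PolySite.incl h0) ((hubbardTTPrimeFermionInteraction 1 tp U).meanEnergyObs 1) -
            (μ : ℂ) • ∑ σ : Fin 2, nAt 0 hz σ -
            (h : ℂ) • (fermionEmbed (PolySite.incl hP) (localPairAt (insert (0 : Site 2) unitSteps) dWaveFormFactor 0) +
              (fermionEmbed (PolySite.incl hP) (localPairAt (insert (0 : Site 2) unitSteps) dWaveFormFactor 0))ᴴ))) -
        ((κm : ℝ) : ℂ) • ((fermionEmbed (PolySite.incl h0) ((hubbardTTPrimeFermionInteraction 1 tp U).meanEnergyObs 1) -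
            (μ : ℂ) • ∑ σ : Fin 2, nAt 0 hz σ -
            (h : ℂ) • (fermionEmbed (PolySite.incl hP) (localPairAt (insert (0 : Site 2) unitSteps) dWaveFormFactor 0) +
              (fermionEmbed (PolySite.incl hP) (localPairAt (insert (0 : Site 2) unitSteps) dWaveFormFactor 0))ᴴ)) -
          (((ℓ : ℚ) : ℝ) : ℂ) • (1 : FermionOp Λ')) =
      gramForm Λm O +
        (∑ k ∈ s, (pairSourceWindowHamiltonianTT' dWaveFormFactor Λ' tp U μ h * fermionEmbed (PolySite.incl hΛ) (B k) -
            fermionEmbed (PolySite.incl hΛ) (B k) * pairSourceWindowHamiltonianTT' dWaveFormFactor Λ' tp U μ h) +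
          ∑ l ∈ tt, (fermionEmbed (PolySite.incl (hsh l)) (fermionEmbed (PolySite.d4Emb (γ l) (wv l) Λ) (Y l)) -
            fermionEmbed (PolySite.incl hΛ) (Y l)) +
          ∑ j ∈ uu, b j • ladderWord (cw j)) +
        (∑ m' ∈ ah, ((dc m' : ℝ) : ℂ) • ((V m')ᴴ - V m') + ∑ k ∈ w, a k • ladderWord (word k)) +
        kktForm (pairSourceWindowHamiltonianTT' dWaveFormFactor Λ' tp U μ h) G
          (fun b' => fermionEmbed (PolySite.incl hΛ) (Bk b')))
    (hr : ((r : ℚ) : ℝ) ≤ c - ∑ k ∈ w, ‖a k‖) :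
    ∃ L₁ : ℕ, PinFieldResponseCeilingAt tp U μ h q L₁ (-r / 2) := by
  obtain ⟨L₁, hL₁⟩ := SourcedCorrLowerRowGS.of_window_certificate_kkt_of_energyRows tp U μ h hE hF hq hΛ h8 h0 hz hP
    h1 hmul hS (-fermionEmbed (PolySite.incl hP) onePointPairWord) hκp hκm hΛm O s B tt γ hγS wv hsh Y uu b cw hcw ah
    dc V w a word hG Bk hcert hr
  have hup : SourcedCorrUpperRowGS tp U μ h q L₁ (-r) Λ' S (fermionEmbed (PolySite.incl hP) onePointPairWord) :=
    fun L _ hInj' hL hqL => SourcedTorusCorrUpperRowGS.of_lower_neg (by rw [neg_neg]; exact hL₁ L hInj' hL hqL)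
  obtain ⟨L₂, hL₂⟩ := hup.onePoint_canonical h1 hmul hS hP
  exact ⟨max L₂ 3, hL₂.pinFieldResponseCeilingAt⟩

end OnePoint

end Summit.Ventures.CertifiedManyBodySolver

end
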